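import Mathlib
import HarnessLib

/-!
# The SHARP average-cut decomposition `mc ≤ 2 · E_B μ(B)` — registered stub `stub_sharpAverageCut` (W20; crux `RankDefectRepresentations` = stmt-PneNP-18923, line `rank-dehn-ladder`, RESHAPE 15)

Rows `x : ι` and columns `y : ι'` of a matrix `R` carry colours `row x, col y : Q` (a finite colour type).  For a colour set
`B : Finset Q` the BIPARTITION CUT of `R` at `B` is
`μ(B) := rank (R ∘ 1[(row ∈ B) × (col ∉ B)]) + rank (R ∘ 1[(row ∉ B) × (col ∈ B)])`.

THEOREM (`stub_sharpAverageCut`, the registered signature verbatim from the ledger stub record of stmt-PneNP-18923 /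
brief `Cruxes/RankDefectRepresentations/Lines/rank-dehn-ladder-briefs-g16c.md` §W20, lead g16): ASSUMING the SHARP LOCAL CUT
INEQUALITY (the conclusion of the neighbouring stub `stub_sharpLocalCut`, W19, taken here as an explicit hypothesis) — for every
colour set `B` there is a colour-block-diagonal `R'_B` with `2 · rank (R − R'_B) ≤ cost(B) := 4 μ(B) + Σ_{i : Q} (μ(B △ {i}) − μ(B))` —
the matrix `R` is within rank `2 · avg_B μ(B)` of a colour-block-diagonal one, stated over `ℕ` as
`2^{#Q} · rank (R − R') ≤ 2 · Σ_{B : Finset Q} μ(B)`.  The constant `2` is optimal (a single off-diagonal block; every one-family weak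
staircase — memo `Lines/rank-dehn-ladder-g16.md` §6).

PROOF (brief §W20; identical to W13 `…AverageCut` (p713772) with the doubled left-hand side).  (1) CANCELLATION `Σ_B cost(B) = 4 Σ_B μ(B)`:
for each colour `i`, `B ↦ B △ {i}` is an involution of `Finset Q` (`symmDiff_symmDiff_cancel_right`), so `Σ_B μ(B △ {i}) = Σ_B μ(B)`
(`Fintype.sum_equiv`) and the signed slack cancels on average.  (2) MINIMUM ≤ AVERAGE: a colour set `B₀` of minimal cost has
`2^{#Q} · cost(B₀) ≤ Σ_B cost(B)` (`Finset.exists_min_image`, `Finset.card_nsmul_le_sum`, `Fintype.card_finset`).  (3) The hypothesis at `B₀`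
supplies the block-diagonal `R'` with `2 rank (R − R') ≤ cost(B₀)`, so `2 · 2^{#Q} · rank (R − R') ≤ 4 Σ_B μ(B)`; halve.  Elementary
bookkeeping over `ℤ`, Mathlib only (the two W13 helpers `sum_cost_eq` / `exists_pow_mul_le_sum` are re-derived inline — 10 lines — so that
this file does not depend on the build state of the W13 module).

HONEST FRAMING: a TOOL of the average-cut lane (memo `Lines/rank-dehn-ladder-g16.md`); it closes no rung by itself; P ≠ NP is not moved;
F-N2 is a FRONTIER formal rung.
-/

set_option linter.dupNamespace false -- `Summit.PneNP.PneNP.…`: summit = sub-problem name (D-0017)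

namespace Summit.PneNP.PneNP.Theorems.CnfIdealGenLengthRankDefectRepresentationsSharpAverageCut

open Finset

/-- **Registered stub `stub_sharpAverageCut`** (W20, line `rank-dehn-ladder`, RESHAPE 15; signature verbatim from the ledger stub record of
stmt-PneNP-18923) = the SHARP AVERAGE-CUT DECOMPOSITION: from the sharp local cut inequality (W19's conclusion, the hypothesis) — for every
colour set `B`, twice the rank distance from `R` to some colour-block-diagonal matrix is at most `4 μ(B) + Σ_{i : Q} (μ(B △ {i}) − μ(B))` —
it follows that `R` is within rank `2 · avg_B μ(B)` of a colour-block-diagonal matrix: `2^{#Q} · rank (R − R') ≤ 2 · Σ_{B : Finset Q} μ(B)`.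
Proof: sum the hypothesis' cost over all `B` (the signed slack cancels since `B ↦ B △ {i}` permutes `Finset Q`), take a `B₀` of minimal cost
(minimum ≤ average over the `2^{#Q}` colour sets), and halve `2 · 2^{#Q} · rank ≤ 4 Σ μ`. -/
theorem stub_sharpAverageCut :
    (∀ (K : Type) [Field K] (ι ι' Q : Type) [Fintype ι] [Fintype ι'] [DecidableEq ι] [DecidableEq ι'] [Fintype Q] [DecidableEq Q]
      (row : ι → Q) (col : ι' → Q) (R : Matrix ι ι' K) (B : Finset Q),
      ∃ R' : Matrix ι ι' K, (∀ x y, row x ≠ col y → R' x y = 0) ∧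
        2 * ((R - R').rank : ℤ) ≤
          4 * (((Matrix.of fun x y => if row x ∈ B ∧ col y ∉ B then R x y else 0).rank : ℤ) +
              ((Matrix.of fun x y => if row x ∉ B ∧ col y ∈ B then R x y else 0).rank : ℤ)) +
          ∑ i : Q, ((((Matrix.of fun x y => if row x ∈ symmDiff B {i} ∧ col y ∉ symmDiff B {i} then R x y else 0).rank : ℤ) +
              ((Matrix.of fun x y => if row x ∉ symmDiff B {i} ∧ col y ∈ symmDiff B {i} then R x y else 0).rank : ℤ)) -
            (((Matrix.of fun x y => if row x ∈ B ∧ col y ∉ B then R x y else 0).rank : ℤ) +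
              ((Matrix.of fun x y => if row x ∉ B ∧ col y ∈ B then R x y else 0).rank : ℤ)))) →
    ∀ (K : Type) [Field K] (ι ι' Q : Type) [Fintype ι] [Fintype ι'] [DecidableEq ι] [DecidableEq ι'] [Fintype Q] [DecidableEq Q]
      (row : ι → Q) (col : ι' → Q) (R : Matrix ι ι' K),
      ∃ R' : Matrix ι ι' K, (∀ x y, row x ≠ col y → R' x y = 0) ∧
        2 ^ Fintype.card Q * (R - R').rank ≤
          2 * ∑ B : Finset Q, ((Matrix.of fun x y => if row x ∈ B ∧ col y ∉ B then R x y else 0).rank +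
              (Matrix.of fun x y => if row x ∉ B ∧ col y ∈ B then R x y else 0).rank)  := by
  intro hSLC K _ ι ι' Q _ _ _ _ _ _ row col R
  -- (1) re-indexing by the toggle involution `B ↦ B △ {i}` of `Finset Q`: `Σ_B f (B △ {i}) = Σ_B f B`
  have hinv : ∀ (f : Finset Q → ℤ) (i : Q), ∑ B : Finset Q, f (symmDiff B {i}) = ∑ B : Finset Q, f B :=
    fun f i =>
    Fintype.sum_equiv
      ⟨fun B => symmDiff B {i}, fun B => symmDiff B {i},
        fun B => symmDiff_symmDiff_cancel_right {i} B, fun B => symmDiff_symmDiff_cancel_right {i} B⟩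
      (fun B => f (symmDiff B {i})) f (fun _ => rfl)
  -- hence the CANCELLATION of the signed slack on average: `Σ_B (4 f B + Σ_i (f (B △ {i}) − f B)) = 4 Σ_B f B`
  have hcancel : ∀ f : Finset Q → ℤ,
      ∑ B : Finset Q, (4 * f B + ∑ i : Q, (f (symmDiff B {i}) - f B)) = 4 * ∑ B : Finset Q, f B := by
    intro f
    have hzero : ∑ i : Q, ∑ B : Finset Q, (f (symmDiff B {i}) - f B) = 0 := by
      refine Finset.sum_eq_zero fun i _ => ?_
      rw [Finset.sum_sub_distrib, hinv f i, sub_self]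
    rw [Finset.sum_add_distrib, Finset.sum_comm, hzero, add_zero, ← Finset.mul_sum]
  -- (2) MINIMUM ≤ AVERAGE over the `2^{#Q}` colour sets: some `B₀` has `2^{#Q} · c B₀ ≤ Σ_B c B`
  have hminavg : ∀ c : Finset Q → ℤ, ∃ B₀ : Finset Q, (2 : ℤ) ^ Fintype.card Q * c B₀ ≤ ∑ B : Finset Q, c B := by
    intro c
    obtain ⟨B₀, -, hmin⟩ :=
      Finset.exists_min_image (Finset.univ : Finset (Finset Q)) c Finset.univ_nonempty
    refine ⟨B₀, ?_⟩
    have h := Finset.card_nsmul_le_sum (Finset.univ : Finset (Finset Q)) c (c B₀)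
      (fun B _ => hmin B (Finset.mem_univ B))
    rw [Finset.card_univ, Fintype.card_finset, nsmul_eq_mul] at h
    exact_mod_cast h
  -- the bipartition cut `μ(B)` (over `ℤ`) and the cost of the sharp local cut inequality at `B`
  let μ : Finset Q → ℤ := fun B =>
    ((Matrix.of fun x y => if row x ∈ B ∧ col y ∉ B then R x y else 0).rank : ℤ) +
      ((Matrix.of fun x y => if row x ∉ B ∧ col y ∈ B then R x y else 0).rank : ℤ)
  let cost : Finset Q → ℤ := fun B => 4 * μ B + ∑ i : Q, (μ (symmDiff B {i}) - μ B)
  -- a colour set of minimal cost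
  obtain ⟨B₀, hB₀⟩ := hminavg cost
  -- (3) the sharp local cut inequality at `B₀`
  obtain ⟨R', hR', hrank⟩ := hSLC K ι ι' Q row col R B₀
  refine ⟨R', hR', ?_⟩
  have hrank' : 2 * ((R - R').rank : ℤ) ≤ cost B₀ := hrank
  have hsum : ∑ B : Finset Q, cost B = 4 * ∑ B : Finset Q, μ B := hcancel μ
  have h2 : (0 : ℤ) ≤ (2 : ℤ) ^ Fintype.card Q := by positivity
  have key2 : (2 : ℤ) ^ Fintype.card Q * (2 * ((R - R').rank : ℤ)) ≤ 4 * ∑ B : Finset Q, μ B :=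
    calc (2 : ℤ) ^ Fintype.card Q * (2 * ((R - R').rank : ℤ))
        ≤ (2 : ℤ) ^ Fintype.card Q * cost B₀ := mul_le_mul_of_nonneg_left hrank' h2
      _ ≤ ∑ B : Finset Q, cost B := hB₀
      _ = 4 * ∑ B : Finset Q, μ B := hsum
  -- halve: `2 · (2^{#Q} · rank) ≤ 2 · (2 Σ μ)`
  have key : (2 : ℤ) ^ Fintype.card Q * ((R - R').rank : ℤ) ≤ 2 * ∑ B : Finset Q, μ B := by
    have h4 : (2 : ℤ) * ((2 : ℤ) ^ Fintype.card Q * ((R - R').rank : ℤ)) ≤ 2 * (2 * ∑ B : Finset Q, μ B) := by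
      calc (2 : ℤ) * ((2 : ℤ) ^ Fintype.card Q * ((R - R').rank : ℤ))
          = (2 : ℤ) ^ Fintype.card Q * (2 * ((R - R').rank : ℤ)) := by ring
        _ ≤ 4 * ∑ B : Finset Q, μ B := key2
        _ = 2 * (2 * ∑ B : Finset Q, μ B) := by ring
    exact le_of_mul_le_mul_left h4 (by norm_num)
  have key' : ((2 ^ Fintype.card Q * (R - R').rank : ℕ) : ℤ) ≤
      ((2 * ∑ B : Finset Q, ((Matrix.of fun x y => if row x ∈ B ∧ col y ∉ B then R x y else 0).rank +
          (Matrix.of fun x y => if row x ∉ B ∧ col y ∈ B then R x y else 0).rank) : ℕ) : ℤ) := by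
    push_cast
    exact key
  exact_mod_cast key'

end Summit.PneNP.PneNP.Theorems.CnfIdealGenLengthRankDefectRepresentationsSharpAverageCut
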